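import Summits.CriticalPhenomena.PercolationContinuityZ3.Theorems.PercNearOneGluingNoHeavyLowerTailSahiE3ExchangeCross
import Mathlib.Tactic.Linarith
import Mathlib.Tactic.Ring
import Mathlib.Tactic.Positivity
import HarnessLib
import HarnessLib.Audit

/-!
# `NoHeavyLowerTail` (crux stmt-CriticalPhenomena-4575), Sahi programme P4: the 2×2 exchange inequality for FLOW-NORMAL certificates — the overflow bound

Support file (cell `prim-l12`, seat P4, generation 28; `--supports stmt-CriticalPhenomena-4575`).  No named facts, no sorries;
standard axioms; def-free.

Context (HOME prim-l12-p4/FROM-prim-l12-p4-gen28-EXCHANGE-REFUTED.md, EVIDENCE-gen28-EXCHANGE-LEMMA-REFUTED.md).  Harris block `(B, w, V)`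
(`w ≥ 0` of mass `1`, slot `V`, `v = w(V)`, `a(X) = w(X∩V)`, `need(X,Y) = x·a(Y) + y·a(X) − v·x·y`), configuration `O ⊆ P ⊇ K, L`,
`O' ⊆ P' ⊇ K', L'`, crossing cells `Ξ₁ = (K∖L)∩(L'∖K')∩V`, `Ξ₂ = (L∖K)∩(K'∖L')∩V`, exchange expressions `EXCH₂`, `EXCH₁` of
`…SahiE3ExchangeCross.exchange_of_noCross₂/₁`.  Generation 28 showed that the CERTIFICATE-FREE conjecture "`EXCH(R) ≥ 0` for every
`R ≥ 0` on `V` satisfying all pair inequalities" is FALSE (two exact Bool⁵ product-measure witnesses with a single crossing point; the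
offending minimisers exceed the flat certificate `(2−v)·w` by factors up to 93), while the natural certificates of the programme are
FLOW-NORMAL: `R ≤ (2−v)·w` on `V` (generation 19; generation 27: the flat certificate `R♮ = (2−v)·w|_V` is admissible and `EXCH(R♮) ≥ 0`).
For flow-normal `R` the CROSS packing `(K,L'), (L,K')` — inadmissible in the certificate-free setting because it over-covers the crossing
cells — costs at most `(2−v)·w(Ξ₁ ∪ Ξ₂)`: by the crossing identity `R(KK'V) + R(LL'V) ≥ R(KL'V) + R(LK'V) − R(Ξ₁) − R(Ξ₂)`
(`supply_ge_cross_sub_crossing`).  Hence the OVERFLOW BOUND: `EXCH ≥ [R-free part] − (2−v)·w(Ξ₁∪Ξ₂)`, i.e. `EXCH ≥ 0` as soon as the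
`R`-free part `X_a + (1−v)·Y` dominates `(2−v)·w(Ξ₁∪Ξ₂)` (`exchange_of_overflow₂`, `exchange_of_overflow₁`; in the pure class this is the
member `T ≥ (1−v)·w(Ξ)` of the HOME memo's flow-normal menu, tight on the tight family).  No Harris hypothesis is needed: the overflow
condition carries the positivity. [this work]
-/

namespace Summit.CriticalPhenomena.PercolationContinuityZ3.Theorems.SahiE3ExchangeOverflow

open Finset SahiE3DimerPacking SahiE3ExchangeCross
open scoped BigOperators

variable {B : Type*} [DecidableEq B]

/-- **Supply versus cross packing.**  For `R ≥ 0` on `V`: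
`R(K∩L'∩V) + R(L∩K'∩V) − R(Ξ₁) − R(Ξ₂) ≤ R(K∩K'∩V) + R(L∩L'∩V)` (crossing identity, the parallel cells dropped). [this work] -/
theorem supply_ge_cross_sub_crossing (R : B → ℝ) (V K L K' L' : Finset B) (hR : ∀ b ∈ V, 0 ≤ R b) :
    ∑ b ∈ (K ∩ L') ∩ V, R b + ∑ b ∈ (L ∩ K') ∩ V, R b
      - ∑ b ∈ ((K \ L) ∩ (L' \ K')) ∩ V, R b - ∑ b ∈ ((L \ K) ∩ (K' \ L')) ∩ V, R b
      ≤ ∑ b ∈ (K ∩ K') ∩ V, R b + ∑ b ∈ (L ∩ L') ∩ V, R b := by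
  have key := exchange_cross_identity R V K L K' L'
  have h1 : 0 ≤ ∑ b ∈ ((K \ L) ∩ (K' \ L')) ∩ V, R b :=
    Finset.sum_nonneg fun b hb => hR b (Finset.mem_inter.1 hb).2
  have h2 : 0 ≤ ∑ b ∈ ((L \ K) ∩ (L' \ K')) ∩ V, R b :=
    Finset.sum_nonneg fun b hb => hR b (Finset.mem_inter.1 hb).2
  linarith

/-- **Overflow bound, bracket 2.**  Weight `w` (so that `v = w(V) ≤ 1` makes `2−v ≥ 1`; not even needed), slot `V`, a weight `R ≥ 0` on `V` satisfying the pair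
inequality at the CROSS pairs `(K,L')`, `(L,K')` and FLOW-NORMAL on the crossing cells (`R(Ξ₁) + R(Ξ₂) ≤ (2−v)·(w(Ξ₁) + w(Ξ₂))`), and the
overflow condition `(2−v)·(w(Ξ₁) + w(Ξ₂)) ≤ X_a + (1−v)·Y₂` with `X_a = a(PP') + a(OO') − p·a(O') − p'·a(O)`,
`Y₂ = Har(P,P') + (p−k)(p'−l') + (p−l)(p'−k')`.  Then the bracket-2 exchange expression is `≥ 0`. [this work] -/
theorem exchange_of_overflow₂ (w R : B → ℝ)
    (V K L P O K' L' P' O' : Finset B) (hR : ∀ b ∈ V, 0 ≤ R b)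
    (hpair₁ : (∑ b ∈ K, w b) * (∑ b ∈ L' ∩ V, w b) + (∑ b ∈ L', w b) * (∑ b ∈ K ∩ V, w b)
        - (∑ b ∈ V, w b) * (∑ b ∈ K, w b) * (∑ b ∈ L', w b) ≤ ∑ b ∈ (K ∩ L') ∩ V, R b)
    (hpair₂ : (∑ b ∈ L, w b) * (∑ b ∈ K' ∩ V, w b) + (∑ b ∈ K', w b) * (∑ b ∈ L ∩ V, w b)
        - (∑ b ∈ V, w b) * (∑ b ∈ L, w b) * (∑ b ∈ K', w b) ≤ ∑ b ∈ (L ∩ K') ∩ V, R b)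
    (hflat : ∑ b ∈ ((K \ L) ∩ (L' \ K')) ∩ V, R b + ∑ b ∈ ((L \ K) ∩ (K' \ L')) ∩ V, R b
        ≤ (2 - ∑ b ∈ V, w b) * (∑ b ∈ ((K \ L) ∩ (L' \ K')) ∩ V, w b + ∑ b ∈ ((L \ K) ∩ (K' \ L')) ∩ V, w b))
    (hover : (2 - ∑ b ∈ V, w b) * (∑ b ∈ ((K \ L) ∩ (L' \ K')) ∩ V, w b + ∑ b ∈ ((L \ K) ∩ (K' \ L')) ∩ V, w b)
        ≤ (∑ b ∈ (P ∩ P') ∩ V, w b) + (∑ b ∈ (O ∩ O') ∩ V, w b)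
          - (∑ b ∈ P, w b) * (∑ b ∈ O' ∩ V, w b) - (∑ b ∈ P', w b) * (∑ b ∈ O ∩ V, w b)
          + (1 - ∑ b ∈ V, w b) * ((∑ b ∈ P ∩ P', w b) - (∑ b ∈ P, w b) * (∑ b ∈ P', w b)
            + ((∑ b ∈ P, w b) - ∑ b ∈ K, w b) * ((∑ b ∈ P', w b) - ∑ b ∈ L', w b)
            + ((∑ b ∈ P, w b) - ∑ b ∈ L, w b) * ((∑ b ∈ P', w b) - ∑ b ∈ K', w b))) :
    0 ≤ (∑ b ∈ (P ∩ P') ∩ V, w b) + (∑ b ∈ (O ∩ O') ∩ V, w b)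
        - (∑ b ∈ P, w b) * (∑ b ∈ O' ∩ V, w b) - (∑ b ∈ P', w b) * (∑ b ∈ O ∩ V, w b)
        + (∑ b ∈ (K ∩ K') ∩ V, R b) + (∑ b ∈ (L ∩ L') ∩ V, R b)
        - ((∑ b ∈ K, w b) * (∑ b ∈ L' ∩ V, w b) + (∑ b ∈ L', w b) * (∑ b ∈ K ∩ V, w b)
            - (∑ b ∈ V, w b) * (∑ b ∈ K, w b) * (∑ b ∈ L', w b))
        - ((∑ b ∈ L, w b) * (∑ b ∈ K' ∩ V, w b) + (∑ b ∈ K', w b) * (∑ b ∈ L ∩ V, w b)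
            - (∑ b ∈ V, w b) * (∑ b ∈ L, w b) * (∑ b ∈ K', w b))
        + (1 - ∑ b ∈ V, w b) * ((∑ b ∈ P ∩ P', w b) - (∑ b ∈ P, w b) * (∑ b ∈ P', w b)
            + ((∑ b ∈ P, w b) - ∑ b ∈ K, w b) * ((∑ b ∈ P', w b) - ∑ b ∈ L', w b)
            + ((∑ b ∈ P, w b) - ∑ b ∈ L, w b) * ((∑ b ∈ P', w b) - ∑ b ∈ K', w b)) := by
  have hsupply := supply_ge_cross_sub_crossing R V K L K' L' hR
  linarith

/-- **Overflow bound, bracket 1.**  Same data with `Y₁ = Har(P,P') + (p−k)(k'−o') + (p−o)(p'−k')`. [this work] -/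
theorem exchange_of_overflow₁ (w R : B → ℝ)
    (V K L P O K' L' P' O' : Finset B) (hR : ∀ b ∈ V, 0 ≤ R b)
    (hpair₁ : (∑ b ∈ K, w b) * (∑ b ∈ L' ∩ V, w b) + (∑ b ∈ L', w b) * (∑ b ∈ K ∩ V, w b)
        - (∑ b ∈ V, w b) * (∑ b ∈ K, w b) * (∑ b ∈ L', w b) ≤ ∑ b ∈ (K ∩ L') ∩ V, R b)
    (hpair₂ : (∑ b ∈ L, w b) * (∑ b ∈ K' ∩ V, w b) + (∑ b ∈ K', w b) * (∑ b ∈ L ∩ V, w b)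
        - (∑ b ∈ V, w b) * (∑ b ∈ L, w b) * (∑ b ∈ K', w b) ≤ ∑ b ∈ (L ∩ K') ∩ V, R b)
    (hflat : ∑ b ∈ ((K \ L) ∩ (L' \ K')) ∩ V, R b + ∑ b ∈ ((L \ K) ∩ (K' \ L')) ∩ V, R b
        ≤ (2 - ∑ b ∈ V, w b) * (∑ b ∈ ((K \ L) ∩ (L' \ K')) ∩ V, w b + ∑ b ∈ ((L \ K) ∩ (K' \ L')) ∩ V, w b))
    (hover : (2 - ∑ b ∈ V, w b) * (∑ b ∈ ((K \ L) ∩ (L' \ K')) ∩ V, w b + ∑ b ∈ ((L \ K) ∩ (K' \ L')) ∩ V, w b)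
        ≤ (∑ b ∈ (P ∩ P') ∩ V, w b) + (∑ b ∈ (O ∩ O') ∩ V, w b)
          - (∑ b ∈ P, w b) * (∑ b ∈ O' ∩ V, w b) - (∑ b ∈ P', w b) * (∑ b ∈ O ∩ V, w b)
          + (1 - ∑ b ∈ V, w b) * ((∑ b ∈ P ∩ P', w b) - (∑ b ∈ P, w b) * (∑ b ∈ P', w b)
            + ((∑ b ∈ P, w b) - ∑ b ∈ K, w b) * ((∑ b ∈ K', w b) - ∑ b ∈ O', w b)
            + ((∑ b ∈ P, w b) - ∑ b ∈ O, w b) * ((∑ b ∈ P', w b) - ∑ b ∈ K', w b))) :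
    0 ≤ (∑ b ∈ (P ∩ P') ∩ V, w b) + (∑ b ∈ (O ∩ O') ∩ V, w b)
        - (∑ b ∈ P, w b) * (∑ b ∈ O' ∩ V, w b) - (∑ b ∈ P', w b) * (∑ b ∈ O ∩ V, w b)
        + (∑ b ∈ (K ∩ K') ∩ V, R b) + (∑ b ∈ (L ∩ L') ∩ V, R b)
        - ((∑ b ∈ K, w b) * (∑ b ∈ L' ∩ V, w b) + (∑ b ∈ L', w b) * (∑ b ∈ K ∩ V, w b)
            - (∑ b ∈ V, w b) * (∑ b ∈ K, w b) * (∑ b ∈ L', w b))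
        - ((∑ b ∈ L, w b) * (∑ b ∈ K' ∩ V, w b) + (∑ b ∈ K', w b) * (∑ b ∈ L ∩ V, w b)
            - (∑ b ∈ V, w b) * (∑ b ∈ L, w b) * (∑ b ∈ K', w b))
        + (1 - ∑ b ∈ V, w b) * ((∑ b ∈ P ∩ P', w b) - (∑ b ∈ P, w b) * (∑ b ∈ P', w b)
            + ((∑ b ∈ P, w b) - ∑ b ∈ K, w b) * ((∑ b ∈ K', w b) - ∑ b ∈ O', w b)
            + ((∑ b ∈ P, w b) - ∑ b ∈ O, w b) * ((∑ b ∈ P', w b) - ∑ b ∈ K', w b)) := by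
  have hsupply := supply_ge_cross_sub_crossing R V K L K' L' hR
  linarith

end Summit.CriticalPhenomena.PercolationContinuityZ3.Theorems.SahiE3ExchangeOverflow
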